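/-
Copyright (c) 2026 the pub-hodgecm-mathlib formalisation cell (harness21).  Prover seat hodgecm-mathlib-LH4-p04 (g5), Track A «(D-RAM) FOUR-FRAME», unit U2H, the census leaf
(ρ2b′-X) `stub_U2H_fixedPointCensus_typeTwo_unit0` — socket (C) (type RamM bottom, dealer WORD #30: lead LH4-p04 + LH4-p06), organ (C-4): the RE-INDEXING between the
order-count socket (hOC-C) and the T5s-RamM weld.  2026-09-04.
-/
import Summits.HodgeConjecture.HodgeConjecture.Theorems.F0P3cDyRamToricLevelCensusRamMDep       -- ★ p857535 (LH4-p06): (R1-A0) `levelSetDep_zero_eq_of_ramified`, `v_one_add_twist_of_gen_ramified` (`a ≤ j`); brings ★ HEAD p857549 + ★ DEFS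
import Summits.HodgeConjecture.HodgeConjecture.Theorems.F0P3cDyRamOrderFiltrationRange        -- ★ (LH4-p12 (g4)) (α): `sum_range_ite_isOrd_eq_sum_range` (indicator → range), `isOrd_pow_iff_le`
import HarnessLib

/-!
# T5c × T5s, type RamM: re-indexing the order-count socket into the T5s-RamM weld's double sum

The census's typed order-count socket (C) (payer LH4-p14 (g4), `SOCKET-hOCC.v1` 869d0c15; M∕E RAMIFIED) presents each side as
`Σ_{j < J+1} [λ ∈ 𝒪_j]·#levelSet(j,0) + Σ_{b ∈ Icc 1 R} Σ_{j < J+1} [λ ∈ 𝒪_j]·q^b·#levelSetDep(j,b;μ)` (cut-offs `J`, `R`), while the T5s-RamM weld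
(`toricCensusSum_ramM_weld`, over ★ p857711 `toricCensusSum_ramM`) consumes `Σ_{j < jλ+1} Σ_{a < jλ+2} q^a·#levelSetDep(j,a;μ)`.  In the RAMIFIED frame
(★ `IsRamifiedQuadraticDatum ρ α d_ρ t`: `α` a uniformiser of `M`, `|α − ρα| = exp(−d_ρ)`; `|ϖE| = exp(−2)`, `ρϖE = ϖE`) these agree as soon as `jλ ≤ J` and `jλ + 1 ≤ R`:
the indicator is `[j ≤ jλ]` (★ (α) `isOrd_pow_iff_le`, with `|λ − ρλ| = |ϖE|^{jλ}·|α − ρα|`), the `a = 0` column passes the depth test for `j ≤ jλ` (★ (R1-A0)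
`levelSetDep_zero_eq_of_ramified`), and EVERY cell with `a ≥ j + 1` is EMPTY (★ `v_one_add_twist_of_gen_ramified`: a Gram-primitive integral dual generator of level `a`
has `a ≤ j` — the trace∕different bound) — for any scalar `h ≠ 0` (no hyperbolic ∕ anisotropic split, no third-field package).  This is ★ p857817
`orderCounts_eq_censusSum_unr` (LH4-p08 (g5), type U) transposed to the RamM letters; nothing else changes.
HONEST LABEL: HC_CM is proved only modulo the 7 printed citations (2 remaining named inputs: hLiu418 = stmt-HodgeConjecture-24832,
h413 = stmt-HodgeConjecture-24833) until rung 0 closes; (ρ2b′-X) :418 is an OPEN prover target — this file is a helper (`--supports`), proofs only.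

## References
* [Kottwitz1986BaseChangeUnits] R. E. Kottwitz, *Base change for unit elements of Hecke algebras*, Compositio Math. 60 (1986), §1 pp. 240–241.
* [Jacobowitz1962] R. Jacobowitz, *Hermitian forms over local fields*, Amer. J. Math. 84 (1962), §4.
* [Flicker1998UnitaryFL] Y. Z. Flicker, *Elementary proof of the fundamental lemma for a unitary group*, Canad. J. Math. 50 (1998), p. 84.
* [Rogawski1990] J. D. Rogawski, *Automorphic Representations of Unitary Groups in Three Variables*, Ann. of Math. Stud. 123 (1990), §4.9 Prop. 4.9.1 (b) p. 55, Lemma 4.9.3 p. 56.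
-/

set_option autoImplicit false

open WithZero IsLocalRing Finset
open scoped Valued Classical

namespace Summit.HodgeConjecture.HodgeConjecture.Cruxes.H413.F0P3cDyRamToricLevelCensusRamM

open Literature.NumberTheory.Automorphic.UnitaryThreeFourFrame (IsRamifiedQuadraticDatum)
open Summit.HodgeConjecture.HodgeConjecture.Cruxes.H413.F0P3cDyRamToricCensusDefs
open Summit.HodgeConjecture.HodgeConjecture.Cruxes.H413.F0P3cDyRamOrderFiltrationRange (sum_range_ite_isOrd_eq_sum_range isOrd_pow_iff_le)

variable {K : Type} [Field K] [Valued K ℤᵐ⁰] {ρ Θ : K →+* K} {α ϖE h : K} {dρ t : ℕ}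

/-! ## §1 Cells above the diagonal `a = j` are empty -/

/-- **NO LEVEL BEYOND THE CONDUCTOR (RamM)**: `levelSet(j,a) = ∅` whenever `j + 1 ≤ a` — a Gram-primitive integral dual generator of level `|ϖE|^a` at conductor `ϖE^j` has
`a ≤ j` (★ `v_one_add_twist_of_gen_ramified`, third clause: `|1 + θ| = |y − ρy|∕|y| ≤ exp(−d_ρ)` against `= exp(2a − 2j − d_ρ)`).  Any scalar `h ≠ 0`.
[cite: Jacobowitz1962, §4] [cite: Flicker1998UnitaryFL, p. 84] -/
theorem levelSet_eq_empty_of_succ_le_ramified (hD : IsRamifiedQuadraticDatum ρ α dρ t) (hvΘ : ∀ x, Valued.v (Θ x) = Valued.v x)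
    (hρϖ : ρ ϖE = ϖE) (hϖE : Valued.v ϖE = exp (-2 : ℤ)) (hh : h ≠ 0) {j a : ℕ} (hja : j + 1 ≤ a) :
    levelSet ρ Θ α ϖE h j a = ∅ := by
  ext Λ
  simp only [Set.mem_empty_iff_false, iff_false]
  rintro ⟨x₀, hx₀, -, hyO, hyN, hya⟩
  simp only [dualGen] at hyO hyN hya
  have h3 := (v_one_add_twist_of_gen_ramified hD hvΘ hρϖ hϖE hh hx₀ hyO hyN hya).2.2
  omega

/-- Hence `#levelSetDep(j,a;μ) = 0` for `j + 1 ≤ a` (RamM, any `h ≠ 0`, any `μ`). [cite: Jacobowitz1962, §4] -/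
theorem ncard_levelSetDep_eq_zero_of_succ_le_ramified (hD : IsRamifiedQuadraticDatum ρ α dρ t) (hvΘ : ∀ x, Valued.v (Θ x) = Valued.v x)
    (hρϖ : ρ ϖE = ϖE) (hϖE : Valued.v ϖE = exp (-2 : ℤ)) (hh : h ≠ 0) (μ : K) {j a : ℕ} (hja : j + 1 ≤ a) :
    (levelSetDep ρ Θ α ϖE h j a μ).ncard = 0 := by
  have hsub : levelSetDep ρ Θ α ϖE h j a μ = ∅ :=
    Set.eq_empty_of_subset_empty fun Λ hΛ => (levelSet_eq_empty_of_succ_le_ramified (Θ := Θ) hD hvΘ hρϖ hϖE hh hja) ▸ hΛ.1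
  rw [hsub, Set.ncard_empty]

/-! ## §2 One row: the socket's `#levelSet(j,0) + Σ_{b ∈ Icc 1 R} q^b·#levelSetDep(j,b;μ)` is the weld's `Σ_{a < jλ+2} q^a·#levelSetDep(j,a;μ)` -/

/-- **ONE ROW (RamM).**  For `j ≤ jλ` and a cut-off `R ≥ jλ + 1`, with the ramified token letters `|μ| = |ϖE|^m`, `|μ − ρμ| = |ϖE^{jλ}(α − ρα)|`:
`#levelSet(j,0) + Σ_{b ∈ Icc 1 R} q^b·#levelSetDep(j,b;μ) = Σ_{a ∈ range (jλ+2)} q^a·#levelSetDep(j,a;μ)` — the `a = 0` column passes the depth test (★ (R1-A0)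
`levelSetDep_zero_eq_of_ramified`) and the cells `a ≥ j + 1` are empty on both sides. [cite: Kottwitz1986BaseChangeUnits, §1 pp. 240–241] [cite: Jacobowitz1962, §4] -/
theorem ncard_levelSet_zero_add_sum_Icc_eq_sum_range_ramified (hD : IsRamifiedQuadraticDatum ρ α dρ t) (hΘΘ : ∀ x, Θ (Θ x) = x)
    (hΘρ : ∀ x, Θ (ρ x) = ρ (Θ x)) (hvΘ : ∀ x, Valued.v (Θ x) = Valued.v x) (hρϖ : ρ ϖE = ϖE) (hϖE : Valued.v ϖE = exp (-2 : ℤ)) (hh : h ≠ 0)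
    {μ : K} {m jl : ℕ} (hμ : Valued.v μ = Valued.v ϖE ^ m) (hjl : Valued.v (μ - ρ μ) = Valued.v (ϖE ^ jl * (α - ρ α))) (q : ℕ)
    {j : ℕ} (hj : j ≤ jl) {R : ℕ} (hR : jl + 1 ≤ R) :
    (levelSet ρ Θ α ϖE h j 0).ncard + ∑ b ∈ Icc 1 R, q ^ b * (levelSetDep ρ Θ α ϖE h j b μ).ncard =
      ∑ a ∈ range (jl + 2), q ^ a * (levelSetDep ρ Θ α ϖE h j a μ).ncard := by
  set f : ℕ → ℕ := fun a => q ^ a * (levelSetDep ρ Θ α ϖE h j a μ).ncard with hf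
  have hf0 : ∀ a, jl + 2 ≤ a → f a = 0 := fun a ha => by
    rw [hf]; dsimp only
    rw [ncard_levelSetDep_eq_zero_of_succ_le_ramified (Θ := Θ) hD hvΘ hρϖ hϖE hh μ (by omega : j + 1 ≤ a), mul_zero]
  -- both sides equal `Σ_{a < R+1} f a`
  have hL : (levelSet ρ Θ α ϖE h j 0).ncard + ∑ b ∈ Icc 1 R, f b = ∑ a ∈ range (R + 1), f a := by
    rw [sum_range_succ', ← Finset.Ico_add_one_right_eq_Icc, sum_Ico_eq_sum_range, add_comm]
    congr 1
    · refine sum_congr (by rw [Nat.add_sub_cancel]) fun k _ => by rw [add_comm]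
    · rw [hf]; dsimp only
      rw [pow_zero, one_mul, levelSetDep_zero_eq_of_ramified hD hΘΘ hΘρ hvΘ hρϖ hϖE hh hμ hjl hj]
  have hRHS : ∑ a ∈ range (jl + 2), f a = ∑ a ∈ range (R + 1), f a :=
    sum_subset (range_subset_range.2 (by omega)) fun a _ hna => hf0 a (by rw [mem_range, not_lt] at hna; omega)
  rw [hL, hRHS]

/-! ## §3 The whole socket side -/

/-- **THE ORDER-COUNT SOCKET RE-INDEXED (type RamM, one scalar).**  With the indicator law `λ ∈ 𝒪_j ⟺ j ≤ jλ` (★ (α) `isOrd_pow_iff_le`), a cut-off `J ≥ jλ`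
and a tube bound `R ≥ jλ + 1`:
`Σ_{j < J+1} [λ ∈ 𝒪_j]·#levelSet(j,0) + Σ_{b ∈ Icc 1 R} Σ_{j < J+1} [λ ∈ 𝒪_j]·q^b·#levelSetDep(j,b;μ) = Σ_{j < jλ+1} Σ_{a < jλ+2} q^a·#levelSetDep(j,a;μ)` —
the left side is the (hOC-C) socket's shape, the right side the T5s-RamM weld's. [cite: Kottwitz1986BaseChangeUnits, §1 pp. 240–241]
[cite: Rogawski1990, §4.9 Prop. 4.9.1 (b) p. 55, Lemma 4.9.3 p. 56] -/
theorem orderCounts_eq_censusSum_ramM (hD : IsRamifiedQuadraticDatum ρ α dρ t) (hΘΘ : ∀ x, Θ (Θ x) = x)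
    (hΘρ : ∀ x, Θ (ρ x) = ρ (Θ x)) (hvΘ : ∀ x, Valued.v (Θ x) = Valued.v x) (hρϖ : ρ ϖE = ϖE) (hϖE : Valued.v ϖE = exp (-2 : ℤ)) (hh : h ≠ 0)
    {μ : K} {m jl : ℕ} (hμ : Valued.v μ = Valued.v ϖE ^ m) (hjl : Valued.v (μ - ρ μ) = Valued.v (ϖE ^ jl * (α - ρ α))) (q : ℕ)
    {lam : K} (hiff : ∀ j, IsOrd ρ α (ϖE ^ j) lam ↔ j ≤ jl) {J : ℕ} (hJ : jl ≤ J) {R : ℕ} (hR : jl + 1 ≤ R) :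
    (∑ j ∈ range (J + 1), (if IsOrd ρ α (ϖE ^ j) lam then (levelSet ρ Θ α ϖE h j 0).ncard else 0)) +
        ∑ b ∈ Icc 1 R, ∑ j ∈ range (J + 1), (if IsOrd ρ α (ϖE ^ j) lam then q ^ b * (levelSetDep ρ Θ α ϖE h j b μ).ncard else 0) =
      ∑ j ∈ range (jl + 1), ∑ a ∈ range (jl + 2), q ^ a * (levelSetDep ρ Θ α ϖE h j a μ).ncard := by
  rw [sum_range_ite_isOrd_eq_sum_range hiff hJ]
  have hinner : ∀ b, ∑ j ∈ range (J + 1), (if IsOrd ρ α (ϖE ^ j) lam then q ^ b * (levelSetDep ρ Θ α ϖE h j b μ).ncard else 0) =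
      ∑ j ∈ range (jl + 1), q ^ b * (levelSetDep ρ Θ α ϖE h j b μ).ncard := fun b =>
    sum_range_ite_isOrd_eq_sum_range hiff hJ _
  simp_rw [hinner]
  rw [sum_comm, ← sum_add_distrib]
  refine sum_congr rfl fun j hj' => ?_
  exact ncard_levelSet_zero_add_sum_Icc_eq_sum_range_ramified hD hΘΘ hΘρ hvΘ hρϖ hϖE hh hμ hjl q (by rw [mem_range] at hj'; omega) hR

/-- **THE INDICATOR LAW IN RamM TOKEN LETTERS**: for the eigenvalue `λ` (integral) with `|λ − ρλ| = |ϖE^{jλ}(α − ρα)|` — the letter shape of ★ p857711's binder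
`jl` — `λ ∈ 𝒪_j ⟺ j ≤ jλ` (★ (α) `isOrd_pow_iff_le` with `0 < |ϖE| = exp(−2) < 1`, `ρα ≠ α` from the datum). [cite: Flicker1998UnitaryFL, p. 84] -/
theorem isOrd_pow_iff_le_ramified (hD : IsRamifiedQuadraticDatum ρ α dρ t) (hϖE : Valued.v ϖE = exp (-2 : ℤ))
    {lam : K} (hlam1 : Valued.v lam ≤ 1) {jl : ℕ} (hjl : Valued.v (lam - ρ lam) = Valued.v (ϖE ^ jl * (α - ρ α))) (j : ℕ) :
    IsOrd ρ α (ϖE ^ j) lam ↔ j ≤ jl := by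
  have hϖ0 : ϖE ≠ 0 := fun h0 => by rw [h0, map_zero] at hϖE; exact (exp_ne_zero hϖE.symm).elim
  have hϖ1 : Valued.v ϖE < 1 := by rw [hϖE, ← exp_zero, exp_lt_exp]; omega
  refine isOrd_pow_iff_le (map_ne_self_of_datum hD) hϖ0 hϖ1 hlam1 ?_ j
  rw [hjl, map_mul, map_pow]

/-! ## §4 (ED. 2) The `hR`-free form: the cut-off read from the NON-EMPTY cells only -/

/-- **THE ORDER-COUNT SOCKET RE-INDEXED FROM THE CELLS (type RamM).**  Same two sides as `orderCounts_eq_censusSum_ramM`, with the cut-off hypothesis weakened from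
`jλ + 1 ≤ R` to **`hRcells : every NON-EMPTY depth cell `(j, b)` with `b ≥ 1` and `λ ∈ 𝒪_j` has `b ≤ R`** — the shape the bottom's lattice-bound `hR` clause delivers through ★
`F0P3cDyRamConeTubeBound.le_of_levelSetDep_nonempty` (LH4-p05): the cells `b > R` of a row are then empty, so `Σ_{b ∈ Icc 1 R} = Σ_{b ∈ Icc 1 (max R (jλ+1))}` and §3 applies
(the RamM twin of ★ p858032 `orderCounts_eq_censusSum_unr_of_cells`, LH4-p08). [cite: Kottwitz1986BaseChangeUnits, §1 pp. 240–241]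
[cite: Rogawski1990, §4.9 Prop. 4.9.1 (b) p. 55, Lemma 4.9.3 p. 56] -/
theorem orderCounts_eq_censusSum_ramM_of_cells (hD : IsRamifiedQuadraticDatum ρ α dρ t) (hΘΘ : ∀ x, Θ (Θ x) = x)
    (hΘρ : ∀ x, Θ (ρ x) = ρ (Θ x)) (hvΘ : ∀ x, Valued.v (Θ x) = Valued.v x) (hρϖ : ρ ϖE = ϖE) (hϖE : Valued.v ϖE = exp (-2 : ℤ)) (hh : h ≠ 0)
    {μ : K} {m jl : ℕ} (hμ : Valued.v μ = Valued.v ϖE ^ m) (hjl : Valued.v (μ - ρ μ) = Valued.v (ϖE ^ jl * (α - ρ α))) (q : ℕ)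
    {lam : K} (hiff : ∀ j, IsOrd ρ α (ϖE ^ j) lam ↔ j ≤ jl) {J : ℕ} (hJ : jl ≤ J) {R : ℕ}
    (hRcells : ∀ j b, 1 ≤ b → IsOrd ρ α (ϖE ^ j) lam → (levelSetDep ρ Θ α ϖE h j b μ).Nonempty → b ≤ R) :
    (∑ j ∈ range (J + 1), (if IsOrd ρ α (ϖE ^ j) lam then (levelSet ρ Θ α ϖE h j 0).ncard else 0)) +
        ∑ b ∈ Icc 1 R, ∑ j ∈ range (J + 1), (if IsOrd ρ α (ϖE ^ j) lam then q ^ b * (levelSetDep ρ Θ α ϖE h j b μ).ncard else 0) =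
      ∑ j ∈ range (jl + 1), ∑ a ∈ range (jl + 2), q ^ a * (levelSetDep ρ Θ α ϖE h j a μ).ncard := by
  rw [sum_range_ite_isOrd_eq_sum_range hiff hJ]
  have hinner : ∀ b, ∑ j ∈ range (J + 1), (if IsOrd ρ α (ϖE ^ j) lam then q ^ b * (levelSetDep ρ Θ α ϖE h j b μ).ncard else 0) =
      ∑ j ∈ range (jl + 1), q ^ b * (levelSetDep ρ Θ α ϖE h j b μ).ncard := fun b =>
    sum_range_ite_isOrd_eq_sum_range hiff hJ _
  simp_rw [hinner]
  rw [sum_comm, ← sum_add_distrib]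
  refine sum_congr rfl fun j hj' => ?_
  have hj : j ≤ jl := by rw [mem_range] at hj'; omega
  -- the cells `b > R` of this row are empty: extend the sum to `Icc 1 (max R (jl + 1))`
  have hext : ∑ b ∈ Icc 1 R, q ^ b * (levelSetDep ρ Θ α ϖE h j b μ).ncard =
      ∑ b ∈ Icc 1 (max R (jl + 1)), q ^ b * (levelSetDep ρ Θ α ϖE h j b μ).ncard := by
    refine sum_subset (Icc_subset_Icc_right (le_max_left _ _)) fun b hb hnb => ?_
    rw [mem_Icc] at hb hnb
    have hempty : levelSetDep ρ Θ α ϖE h j b μ = ∅ :=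
      Set.not_nonempty_iff_eq_empty.1 fun hne => hnb ⟨hb.1, hRcells j b hb.1 ((hiff j).2 hj) hne⟩
    rw [hempty, Set.ncard_empty, mul_zero]
  rw [hext]
  exact ncard_levelSet_zero_add_sum_Icc_eq_sum_range_ramified hD hΘΘ hΘρ hvΘ hρϖ hϖE hh hμ hjl q hj (le_max_right _ _)

end Summit.HodgeConjecture.HodgeConjecture.Cruxes.H413.F0P3cDyRamToricLevelCensusRamM
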